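import Mathlib.Analysis.SpecialFunctions.Pow.Real
import Mathlib.NumberTheory.Real.Irrational
import Mathlib.RingTheory.Polynomial.Basic
import Mathlib.Tactic.ComputeDegree
import Mathlib.Tactic.LinearCombination
import Mathlib.Analysis.Complex.Basic
import Mathlib.LinearAlgebra.Multilinear.Basic
import Mathlib.LinearAlgebra.Vandermonde
import Mathlib.LinearAlgebra.Matrix.NonsingularInverse
import Mathlib.Algebra.BigOperators.Fin
import HarnessLib

/-!
# Ring 2 · AbelianAll (ab-weil-1, gen 139, part BC-a) — the biquadratic carrier `P_d` of
  `E = ℚ(√-d, √2)` and the rational weights of the base-change lift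

research route conditional on HC_CM; not a corollary; Q11.4-sentence-2 already refuted in dim ≥ 3.
`HC_CM` (`Theses.RankFourFaces.CMAbelianHodge`) does not occur in this file and no open case of the Hodge
conjecture is claimed. This is the ARITHMETIC layer of the kernel proof of LEMMA BC
(`Ring2AbelianAllWeilBaseChangeRestriction.weilBaseChangeRestriction_holds`, which bears on the edge
H2 → H1 = rung R3 `WeilClassesCMField` ⟹ rung R∞ `WeilClassesImaginaryQuadratic` of `Theorems/WeilTypeLadder`):
pure algebra over `ℤ[T]`, `ℚ`, `ℂ`; no abelian variety occurs here.

## What is proved (0 sorry)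

* §1 `bcQuartic d = T⁴ + (2d − 4)T² + (d + 2)² ∈ ℤ[T]` — the minimal polynomial of `√2 + i√d`, i.e. of a
  generator of the biquadratic CM field `E = ℚ(√-d, √2) = K(√2)`, `K = ℚ(√-d)` — is monic of degree `4`
  (`bcQuartic_monic`, `bcQuartic_natDegree`), IRREDUCIBLE over `ℚ` for every `d ≥ 1`
  (`bcQuartic_irreducible`: no rational root since `P_d(x) = (x² + d − 2)² + 8d > 0`; no rational quadratic
  factor since that forces `a² = 8` or a negative square), has NO REAL complex root
  (`conj_ne_self_of_bcQuartic`), every complex root has `|ρ|² = d + 2` (`normSq_of_bcQuartic`), and ONE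
  polynomial `Q_d = (−T³ + (4 − 2d)T)/(d + 2) ∈ ℚ[T]` carries every complex root to its conjugate
  (`exists_conjPolynomial_bcQuartic`: `E` is a CM field with involution `Q_d`); `P_d(μ + σ) = 0` whenever
  `μ² = −d`, `σ² = 2` (`bcQuartic_root`); `P_d` evaluated in any ring (`eval₂_bcQuartic`).
* §2 generic linear algebra of the lift: the multilinear expansion `F(x + t·y) = Σ_s t^{|sᶜ|} F(s.piecewise x y)`
  (`multilinear_apply_add_smul`); RATIONAL weights `r₀, …, r_{N−1}` with prescribed power sums
  `Σ_m r_m m^k = e_k` (`k < N`, Vandermonde; `exists_rat_weights`); the parity weights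
  `e_k = ((√2)^k + (−√2)^k)/2 = 2^{k/2} · [k even] ∈ ℚ` (`evenPowWeight`, `sqrt_two_pow_add_neg_pow`).

What is NOT proved or claimed: anything about abelian varieties (parts BC-b, BC-c); no Literature fact is
introduced; no internally-minted statement is cited as a fact.

## References

* [vanGeemen1994HodgeAV] B. van Geemen, An introduction to the Hodge conjecture for abelian varieties,
  LNM 1594 (1994), 4.9–4.12 (Weil classes, the field `K` acting on `H¹`).
* [MoonenZarhin1998WeilClasses] B. Moonen, Yu. Zarhin, Weil classes on abelian varieties,
  J. reine angew. Math. 496 (1998), §1 (`W_K` for a CM field `K`).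
-/

noncomputable section

set_option linter.dupNamespace false

open Polynomial
open scoped BigOperators

namespace Summit.HodgeConjecture.HodgeConjecture.Ring2.AbelianAll

/-! ### §1 The quartic `P_d = T⁴ + (2d − 4)T² + (d + 2)²` -/

section Quartic

/-- `P_d = T⁴ + (2d − 4)·T² + (d + 2)² ∈ ℤ[T]`, the minimal polynomial of `√2 + i√d` — a generator of
the biquadratic CM field `E = ℚ(√-d, √2)`. -/
def bcQuartic (d : ℕ) : Polynomial ℤ :=
  X ^ 4 + C (2 * (d : ℤ) - 4) * X ^ 2 + C (((d : ℤ) + 2) ^ 2)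

variable (d : ℕ)

/-- `P_d` is monic. -/
theorem bcQuartic_monic : (bcQuartic d).Monic := by
  unfold bcQuartic; monicity!

/-- `P_d` has degree `4`. -/
theorem bcQuartic_natDegree : (bcQuartic d).natDegree = 4 := by
  unfold bcQuartic; compute_degree!

/-- Evaluation of `P_d` in any ring (also noncommutative: used in `End (A × A)`). -/
theorem eval₂_bcQuartic {R : Type*} [Ring R] (x : R) :
    Polynomial.eval₂ (Int.castRingHom R) x (bcQuartic d) =
      x ^ 4 + ((2 * (d : ℤ) - 4 : ℤ) : R) * x ^ 2 + ((((d : ℤ) + 2) ^ 2 : ℤ) : R) := by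
  unfold bcQuartic
  simp only [Polynomial.eval₂_add, Polynomial.C_mul_X_pow_eq_monomial, Polynomial.eval₂_monomial,
    Polynomial.eval₂_X_pow, Polynomial.eval₂_C]
  rfl

/-- `P_d` evaluated at a complex number (the `ℂ` instance of `eval₂_bcQuartic`). -/
theorem eval₂_bcQuartic_complex (x : ℂ) :
    Polynomial.eval₂ (Int.castRingHom ℂ) x (bcQuartic d) =
      x ^ 4 + (2 * (d : ℂ) - 4) * x ^ 2 + ((d : ℂ) + 2) ^ 2 := by
  rw [eval₂_bcQuartic]; push_cast; ring

/-- The image of `P_d` in `ℚ[T]`. -/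
theorem bcQuartic_map :
    (bcQuartic d).map (Int.castRingHom ℚ) =
      X ^ 4 + C (2 * (d : ℚ) - 4) * X ^ 2 + C (((d : ℚ) + 2) ^ 2) := by
  unfold bcQuartic
  simp only [Polynomial.map_add, Polynomial.map_mul, Polynomial.map_pow, Polynomial.map_X,
    Polynomial.map_C]
  have h1 : (Int.castRingHom ℚ) (2 * (d : ℤ) - 4) = 2 * (d : ℚ) - 4 := by simp
  have h2 : (Int.castRingHom ℚ) (((d : ℤ) + 2) ^ 2) = ((d : ℚ) + 2) ^ 2 := by simp
  rw [h1, h2]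

/-- No rational `a` with `a² = 8` (`√2` is irrational). -/
theorem no_rat_sq_eq_eight (a : ℚ) (h : a ^ 2 = 8) : False := by
  have hsq : ((a / 2 : ℚ)) ^ 2 = 2 := by linear_combination h / 4
  have hirr : Irrational (Real.sqrt 2) := irrational_sqrt_two
  have h5 : Real.sqrt 2 = |(((a / 2 : ℚ)) : ℝ)| := by
    rw [← Real.sqrt_sq_eq_abs]; congr 1; exact_mod_cast hsq.symm
  exact hirr.ne_rat |a / 2| (by rw [h5]; push_cast; rfl)

/-- **`P_d` is irreducible over `ℚ` for `d ≥ 1`** (exclusion of rational linear and quadratic factors of the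
monic quartic: a rational root contradicts `P_d(x) = (x² + d − 2)² + 8d > 0`; a factorisation into two
rational monic quadratics `(x² + ax + b)(x² + cx + e)` forces `c = −a` and then either `a = 0`,
`(b − e)² = −32d`, or `e = b = ±(d + 2)`, `a² ∈ {8, −4d}`). -/
theorem bcQuartic_irreducible_rat (hd : 0 < d) :
    Irreducible (X ^ 4 + C (2 * (d : ℚ) - 4) * X ^ 2 + C (((d : ℚ) + 2) ^ 2) : Polynomial ℚ) := by
  set α : ℚ := 2 * (d : ℚ) - 4 with hα
  set β : ℚ := ((d : ℚ) + 2) ^ 2 with hβ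
  have hd' : (1 : ℚ) ≤ d := by exact_mod_cast hd
  have hm : (X ^ 4 + C α * X ^ 2 + C β : Polynomial ℚ).Monic := by monicity!
  have hdeg : (X ^ 4 + C α * X ^ 2 + C β : Polynomial ℚ).natDegree = 4 := by compute_degree!
  have hne1 : (X ^ 4 + C α * X ^ 2 + C β : Polynomial ℚ) ≠ 1 := by
    intro h; have := congrArg Polynomial.natDegree h; rw [hdeg] at this; simp at this
  rw [hm.irreducible_iff_lt_natDegree_lt hne1]
  intro q hq hqdeg
  rw [hdeg, Finset.mem_Ioc] at hqdeg
  rintro ⟨r, hr⟩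
  have hrm : r.Monic := Polynomial.Monic.of_mul_monic_left hq (hr ▸ hm)
  have hsum : q.natDegree + r.natDegree = 4 := by
    rw [← Polynomial.Monic.natDegree_mul hq hrm, ← hr, hdeg]
  have hev : ∀ x : ℚ, x ^ 4 + α * x ^ 2 + β = Polynomial.eval x q * Polynomial.eval x r := by
    intro x
    have := congrArg (Polynomial.eval x) hr
    simpa [Polynomial.eval_mul] using this
  rcases Nat.lt_or_ge q.natDegree 2 with h1 | h2
  · -- degree 1: a rational root, but `P_d(x) = (x² + d − 2)² + 8d > 0`
    have hq1 : q.natDegree = 1 := by omega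
    set a0 := q.coeff 0 with ha0
    have hqf : q = X + C a0 := hq.eq_X_add_C hq1
    have h0 := hev (-a0)
    rw [hqf, Polynomial.eval_add, Polynomial.eval_X, Polynomial.eval_C] at h0
    have h0' : a0 ^ 4 + α * a0 ^ 2 + β = 0 := by
      have : (-a0) ^ 4 + α * (-a0) ^ 2 + β = 0 := by rw [h0]; ring
      linear_combination this
    rw [hα, hβ] at h0'
    nlinarith [sq_nonneg a0, sq_nonneg (a0 ^ 2 + d - 2)]
  · -- degree 2: a rational quadratic factor
    have hq2 : q.natDegree = 2 := by omega
    have hr2 : r.natDegree = 2 := by omega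
    set a := q.coeff 1 with ha
    set b := q.coeff 0 with hb
    set c := r.coeff 1 with hc
    set e := r.coeff 0 with he
    have hqf : q = X ^ 2 + C a * X + C b := by
      have := hq.as_sum; rw [hq2] at this; rw [this]
      simp only [Finset.sum_range_succ, Finset.sum_range_zero, zero_add, pow_zero, mul_one, pow_one]; ring
    have hrf : r = X ^ 2 + C c * X + C e := by
      have := hrm.as_sum; rw [hr2] at this; rw [this]
      simp only [Finset.sum_range_succ, Finset.sum_range_zero, zero_add, pow_zero, mul_one, pow_one]; ring
    have hev' : ∀ x : ℚ, x ^ 4 + α * x ^ 2 + β = (x ^ 2 + a * x + b) * (x ^ 2 + c * x + e) := by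
      intro x; have := hev x; rw [hqf, hrf] at this
      simpa [Polynomial.eval_add, Polynomial.eval_mul, Polynomial.eval_pow, Polynomial.eval_X,
        Polynomial.eval_C] using this
    have e0 := hev' 0
    have e1 := hev' 1
    have em1 := hev' (-1)
    have e2 := hev' 2
    have em2 := hev' (-2)
    have hA3 : a + c = 0 := by linear_combination (-(e2 - em2) + 2 * (e1 - em1)) / 12
    have hA1 : a * e + b * c = 0 := by
      linear_combination (-(e1 - em1)) / 2 - (-(e2 - em2) + 2 * (e1 - em1)) / 12
    have hA0 : b * e = β := by linear_combination -e0
    have hA2 : b + e + a * c = α := by linear_combination (-(e1 + em1)) / 2 + e0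
    have hc' : c = -a := by linear_combination hA3
    rw [hc'] at hA1 hA2
    have had : a * (e - b) = 0 := by linear_combination hA1
    rcases mul_eq_zero.1 had with h0 | heb
    · -- `a = 0`: `b + e = 2d − 4`, `be = (d+2)²`, so `(b − e)² = −32d < 0`
      rw [h0] at hA2
      have hbe : b + e = α := by linear_combination hA2
      rw [hα] at hbe; rw [hβ] at hA0
      nlinarith [sq_nonneg (b - e)]
    · -- `e = b`: `b² = (d+2)²` and `a² = 2b − 2d + 4 ∈ {8, −4d}`
      have heb' : e = b := by linarith
      rw [heb'] at hA0 hA2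
      rw [hβ] at hA0; rw [hα] at hA2
      have hb2 : (b - (d + 2)) * (b + (d + 2)) = 0 := by linear_combination hA0
      rcases mul_eq_zero.1 hb2 with hb1 | hb1
      · have : a ^ 2 = 8 := by nlinarith
        exact no_rat_sq_eq_eight a this
      · nlinarith [sq_nonneg a]

/-- **`P_d ⊗ ℚ` is irreducible** (`d ≥ 1`): `ℚ[T]/(P_d) ≅ E = ℚ(√-d, √2)` is a field of degree `4`. -/
theorem bcQuartic_irreducible (hd : 0 < d) :
    Irreducible ((bcQuartic d).map (Int.castRingHom ℚ)) := by
  rw [bcQuartic_map]; exact bcQuartic_irreducible_rat d hd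

/-- The complex roots of `P_d` are NON-REAL (`P_d(x) = (x² + d − 2)² + 8d > 0` on `ℝ`). -/
theorem conj_ne_self_of_bcQuartic (hd : 0 < d) {ρ : ℂ}
    (hρ : Polynomial.eval₂ (Int.castRingHom ℂ) ρ (bcQuartic d) = 0) :
    starRingEnd ℂ ρ ≠ ρ := by
  rw [eval₂_bcQuartic_complex] at hρ
  intro hc
  have hre : ((ρ.re : ℝ) : ℂ) = ρ := Complex.conj_eq_iff_re.mp hc
  have hr : ((ρ.re ^ 4 + (2 * (d : ℝ) - 4) * ρ.re ^ 2 + ((d : ℝ) + 2) ^ 2 : ℝ) : ℂ) = 0 := by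
    push_cast; rw [hre]; exact hρ
  have hr' : ρ.re ^ 4 + (2 * (d : ℝ) - 4) * ρ.re ^ 2 + ((d : ℝ) + 2) ^ 2 = 0 := by exact_mod_cast hr
  have hd' : (1 : ℝ) ≤ d := by exact_mod_cast hd
  nlinarith [sq_nonneg ρ.re, sq_nonneg (ρ.re ^ 2 + d - 2)]

/-- Every complex root `ρ` of `P_d` has `|ρ|² = d + 2`. -/
theorem normSq_of_bcQuartic {ρ : ℂ}
    (hρ : Polynomial.eval₂ (Int.castRingHom ℂ) ρ (bcQuartic d) = 0) :
    Complex.normSq ρ = (d : ℝ) + 2 := by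
  rw [eval₂_bcQuartic_complex] at hρ
  -- `u = ρ² + (d − 2)` has `u² = −8d`, hence is purely imaginary with `|u|² = 8d`
  set u : ℂ := ρ ^ 2 + ((d : ℂ) - 2) with hu
  have hu2 : u ^ 2 = -8 * (d : ℂ) := by rw [hu]; linear_combination hρ
  have hre : u.re * u.re - u.im * u.im = -8 * (d : ℝ) := by
    have := congrArg Complex.re hu2
    simp [pow_two, Complex.mul_re] at this
    linarith
  have him : 2 * (u.re * u.im) = 0 := by
    have := congrArg Complex.im hu2
    simp [pow_two, Complex.mul_im] at this
    linarith
  have hure : u.re = 0 := by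
    by_contra h
    have : u.im = 0 := by
      have := mul_eq_zero.1 (by linarith : u.re * u.im = 0)
      exact this.resolve_left h
    rw [this] at hre
    have hd0 : (0 : ℝ) ≤ d := by exact_mod_cast (Nat.zero_le d)
    have h1 : u.re * u.re = -8 * (d : ℝ) := by simpa using hre
    have h2 : 0 < u.re * u.re := mul_self_pos.2 h
    linarith
  -- `ρ² = u + (2 − d)`, so `|ρ²|² = (2 − d)² + |u|² = (d + 2)²`
  have hρ2 : ρ ^ 2 = u + (2 - (d : ℂ)) := by rw [hu]; ring
  have hn2 : Complex.normSq (ρ ^ 2) = ((d : ℝ) + 2) ^ 2 := by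
    rw [hρ2, Complex.normSq_apply]
    have h1 : (u + (2 - (d : ℂ))).re = 2 - (d : ℝ) := by simp [hure]
    have h2 : (u + (2 - (d : ℂ))).im = u.im := by simp
    rw [h1, h2]
    nlinarith [hre, hure]
  have hn : Complex.normSq ρ ^ 2 = ((d : ℝ) + 2) ^ 2 := by rw [← hn2, map_pow]
  have h0 : 0 ≤ Complex.normSq ρ := Complex.normSq_nonneg ρ
  have hd0 : (0 : ℝ) ≤ (d : ℝ) + 2 := by positivity
  nlinarith [sq_nonneg (Complex.normSq ρ - ((d : ℝ) + 2)), sq_nonneg (Complex.normSq ρ + ((d : ℝ) + 2))]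

/-- **The CM involution of `E` is a polynomial**: `Q_d = (−T³ + (4 − 2d)T)/(d + 2) ∈ ℚ[T]` carries every
complex root `ρ` of `P_d` to `ρ̄ = (d + 2)/ρ`. -/
theorem exists_conjPolynomial_bcQuartic :
    ∃ Q : Polynomial ℚ, ∀ ρ : ℂ, Polynomial.eval₂ (Int.castRingHom ℂ) ρ (bcQuartic d) = 0 →
      Polynomial.eval₂ (algebraMap ℚ ℂ) ρ Q = starRingEnd ℂ ρ := by
  refine ⟨C (1 / ((d : ℚ) + 2)) * (-X ^ 3 + C (4 - 2 * (d : ℚ)) * X), fun ρ hρ => ?_⟩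
  have hn := normSq_of_bcQuartic d hρ
  rw [eval₂_bcQuartic_complex] at hρ
  have hρ0 : ρ ≠ 0 := by
    intro h; rw [h, map_zero] at hn
    have : (0 : ℝ) ≤ d := by exact_mod_cast Nat.zero_le d
    linarith
  have hconj : starRingEnd ℂ ρ = (((d : ℝ) + 2 : ℝ) : ℂ) / ρ := by
    rw [eq_div_iff hρ0, ← hn, mul_comm, Complex.mul_conj]
  have hd2 : ((d : ℂ) + 2) ≠ 0 := by
    have : ((d : ℂ) + 2) = (((d : ℝ) + 2 : ℝ) : ℂ) := by push_cast; ring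
    rw [this, Complex.ofReal_ne_zero]; positivity
  rw [hconj]
  simp only [Polynomial.eval₂_mul, Polynomial.eval₂_C, Polynomial.eval₂_add, Polynomial.eval₂_neg,
    Polynomial.eval₂_pow, Polynomial.eval₂_X, eq_ratCast]
  push_cast
  rw [div_mul_eq_mul_div, one_mul, div_eq_div_iff hd2 hρ0]
  linear_combination (-1 : ℂ) * hρ

/-- `P_d(μ + σ) = 0` whenever `μ² = −d` and `σ² = 2`: the four complex roots `±i√d ± √2` of `P_d`. -/
theorem bcQuartic_root {μ σ : ℂ} (hμ : μ ^ 2 = -(d : ℂ)) (hσ : σ ^ 2 = 2) :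
    Polynomial.eval₂ (Int.castRingHom ℂ) (μ + σ) (bcQuartic d) = 0 := by
  rw [eval₂_bcQuartic_complex]
  have h2 : (μ + σ) ^ 2 = 2 - (d : ℂ) + 2 * μ * σ := by linear_combination hμ + hσ
  have h4 : (μ + σ) ^ 4 = (2 - (d : ℂ) + 2 * μ * σ) ^ 2 := by
    rw [show (μ + σ) ^ 4 = ((μ + σ) ^ 2) ^ 2 by ring, h2]
  rw [h4, h2]
  linear_combination (4 * σ ^ 2) * hμ + (-4 * (d : ℂ)) * hσ

/-- `μ² = −d` for `μ = i√d`. -/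
theorem I_mul_sqrt_sq : (Complex.I * (Real.sqrt d : ℂ)) ^ 2 = -(d : ℂ) := by
  rw [mul_pow, Complex.I_sq, ← Complex.ofReal_pow, Real.sq_sqrt (Nat.cast_nonneg d)]
  push_cast; ring

end Quartic

/-! ### §2 Generic linear algebra of the lift: subset expansion, Vandermonde weights, parity weights -/

section Weights

/-- Multilinear expansion of `F(x + t·y)` over subsets: the term of `s` has the `x`'s on `s` and the
`t·y`'s off `s`, contributing `t^{|sᶜ|} · F(s.piecewise x y)`. -/
theorem multilinear_apply_add_smul {R ι M N : Type*} [CommSemiring R] [Fintype ι] [DecidableEq ι]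
    [AddCommMonoid M] [Module R M] [AddCommMonoid N] [Module R N]
    (F : MultilinearMap R (fun _ : ι => M) N) (x y : ι → M) (t : R) :
    F (x + t • y) = ∑ s : Finset ι, t ^ sᶜ.card • F (s.piecewise x y) := by
  rw [MultilinearMap.map_add_univ]
  refine Finset.sum_congr rfl fun s _ => ?_
  have h : s.piecewise x (t • y) = sᶜ.piecewise (fun i => t • s.piecewise x y i) (s.piecewise x y) := by
    funext i
    by_cases hi : i ∈ s
    · have hi' : i ∉ sᶜ := by rw [Finset.mem_compl]; exact not_not.mpr hi
      rw [Finset.piecewise_eq_of_mem _ _ _ hi, Finset.piecewise_eq_of_notMem _ _ _ hi',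
        Finset.piecewise_eq_of_mem _ _ _ hi]
    · have hi' : i ∈ sᶜ := Finset.mem_compl.mpr hi
      rw [Finset.piecewise_eq_of_notMem _ _ _ hi, Finset.piecewise_eq_of_mem _ _ _ hi',
        Finset.piecewise_eq_of_notMem _ _ _ hi, Pi.smul_apply]
  rw [h, MultilinearMap.map_piecewise_smul, Finset.prod_const]

/-- **Rational weights with prescribed power sums** at the nodes `0, 1, …, N − 1`:
`Σ_i r_i · i^k = e_k` for all `k < N` (the Vandermonde matrix of distinct rational nodes is invertible). -/
theorem exists_rat_weights (N : ℕ) (e : ℕ → ℚ) :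
    ∃ r : Fin N → ℚ, ∀ k < N, ∑ i : Fin N, r i * (i : ℚ) ^ k = e k := by
  classical
  let v : Fin N → ℚ := fun i => (i : ℚ)
  have hv : Function.Injective v := by
    intro i j h
    have h' : ((i : ℕ) : ℚ) = ((j : ℕ) : ℚ) := h
    exact Fin.ext (by exact_mod_cast h')
  have hunit : IsUnit (Matrix.vandermonde v).det :=
    isUnit_iff_ne_zero.mpr (Matrix.det_vandermonde_ne_zero_iff.mpr hv)
  let e' : Fin N → ℚ := fun k => e k
  refine ⟨Matrix.vecMul e' (Matrix.vandermonde v)⁻¹, fun k hk => ?_⟩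
  have h := Matrix.vecMul_vecMul e' (Matrix.vandermonde v)⁻¹ (Matrix.vandermonde v)
  rw [Matrix.nonsing_inv_mul _ hunit, Matrix.vecMul_one] at h
  have hk' := congrFun h ⟨k, hk⟩
  rw [show e k = e' ⟨k, hk⟩ from rfl, ← hk']
  rfl

/-- The parity weights `e_k = ((√2)^k + (−√2)^k)/2 ∈ ℚ`: `2^{k/2}` for even `k`, `0` for odd `k`. -/
def evenPowWeight (k : ℕ) : ℚ := if Even k then 2 ^ (k / 2) else 0

/-- `(√2)^k + (−√2)^k = 2 e_k`. -/
theorem sqrt_two_pow_add_neg_pow (k : ℕ) :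
    ((Real.sqrt 2 : ℝ) : ℂ) ^ k + (-((Real.sqrt 2 : ℝ) : ℂ)) ^ k = 2 * (evenPowWeight k : ℂ) := by
  have h2 : ((Real.sqrt 2 : ℝ) : ℂ) ^ 2 = 2 := by
    rw [← Complex.ofReal_pow, Real.sq_sqrt (by norm_num : (0 : ℝ) ≤ 2)]; push_cast; rfl
  rcases Nat.even_or_odd k with ⟨j, rfl⟩ | ⟨j, rfl⟩
  · have hj : (j + j) / 2 = j := by omega
    have hp : ((Real.sqrt 2 : ℝ) : ℂ) ^ (j + j) = 2 ^ j := by rw [← two_mul, pow_mul, h2]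
    rw [evenPowWeight, if_pos ⟨j, rfl⟩, hj, Even.neg_pow ⟨j, rfl⟩, hp]
    push_cast; ring
  · rw [evenPowWeight, if_neg (Nat.not_even_iff_odd.mpr ⟨j, rfl⟩), Odd.neg_pow ⟨j, rfl⟩]
    push_cast; ring

/-- The zeroth parity weight is `1` (so the rational weights sum to `1`). -/
theorem evenPowWeight_zero : evenPowWeight 0 = 1 := by
  simp [evenPowWeight]

end Weights

end Summit.HodgeConjecture.HodgeConjecture.Ring2.AbelianAll

end
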